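import Summits.ResolutionOfSingularities.ResolutionOfSingularities.Theorems.RisoStrataRisoCentresResolveCollapse
import Summits.ResolutionOfSingularities.ResolutionOfSingularities.Theorems.RisoStrataRisoCentresResolvePlumbing
import Summits.ResolutionOfSingularities.ResolutionOfSingularities.Theses.RisoStrata

/-!
# Crux `RisoCentresResolve` (stmt-ResolutionOfSingularities-18546) — negative lemma modulo the construction
# `CollapsedTowerLoop`: a loop of the constant word along whose OWN stages the typed rtd collapses

Route `ResolutionOfSingularities/RisoStrata`, crux `RisoCentresResolve`, lead c3 (line `Sketch`). This is
the LOCAL (honest) form of lead c2's `RisoCentresResolve_false_of_CollapsedTopLoop`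
(`RisoCentresResolveFalseOfCollapsedTopLoop.lean`). The construction `CollapsedTopLoop` of that file
asks for collapse (`¬ Rtd B m 1` at every singular maximal ideal) of EVERY `k`-subalgebra `B ⊆ K`; but
every `K` of transcendence degree `≥ 2` contains `k[T², T³, z]` (cusp × line, `T, z` algebraically
independent), whose singular maximal ideals have typed `Rtd ≥ 1` (`bddLetters_rtd`,
`…Negative/RisoCentresResolveBddLettersRtd.lean`), while for transcendence degree `≤ 1` the constant
word terminates (`rcr_localUnif_curve`): `CollapsedTopLoop` is unsatisfiable and that lemma is
vacuous. What a refuter CAN hope to build is collapse along the stages the loop actually visits: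

`CollapsedTowerLoop`: a prime `p`, an algebraically closed `k` of characteristic `p`, a presentation
`K = k(hᵢ/hⱼ)` such that for every length `L` there are a valuation ring `O ⊇ k`, a chart
`k[hᵢ/hⱼ] ⊆ O` and denominators `x`, admissible for the constant word `0^L`, with (LOOP) a NON-regular
local ring at the centre of `O` at stage `L`, and (LOCAL COLLAPSE) at every stage `t < L` of THIS
tower every singular maximal ideal `m` of the stage has typed `rtd = 0` (`¬ Rtd B_t m 1`, route
predicate inline) — e.g. all its singular points lie on purely inseparable singular families
(`pcusp_not_rtd_one`).
Then `RisoCentresResolve` fails: for the crux's schedule `sched` (length `L`) and the tower of the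
hypothesis, the `sched`-tower with the same denominators coincides stage by stage with the `0^L`-tower
(`risoStep_eq_of_collapse`, collapse needed only at the current stage), admissibility transfers
(`risoValid_iff_of_collapse`), and the crux's regularity contradicts LOOP.

`RisoCentresResolve_false_of_CollapsedTowerLoop : CollapsedTowerLoop → ¬ RisoCentresResolve`
(`CollapsedTowerLoop` is the `def` of this file, to be filed as a construction item; it supersedes
`CollapsedTopLoop`). One `def … : Prop`; kernel-only.
-/

noncomputable section

set_option linter.dupNamespace false -- mandated namespace of this single-conjunct summit

namespace Summit.ResolutionOfSingularities.ResolutionOfSingularities.Theorems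

open Summit.ResolutionOfSingularities.ResolutionOfSingularities.Theses.RisoStrata

/-- **The construction a refuter must supply (`CollapsedTowerLoop`).** A prime `p`, an
algebraically closed field `k` of characteristic `p` and a presentation `K = k(hᵢ/hⱼ)` such that
for every length `L` some valuation ring `O ⊇ k`, chart `k[hᵢ/hⱼ] ⊆ O` and denominators `x`
admissible for the constant word `0^L` give (LOOP) a NON-regular local ring at the centre of `O` at
stage `L`, while (LOCAL COLLAPSE) every singular maximal ideal of every stage `t < L` of this tower
has typed `rtd = 0` (`¬ Rtd B_t m 1`, route predicate inline). -/
def CollapsedTowerLoop : Prop := ∃ (p : ℕ) (_ : p.Prime) (k : Type) (_ : Field k) (_ : CharP k p) (_ : IsAlgClosed k) (K : Type) (_ : Field K) (_ : Algebra k K) (N : ℕ) (h : Fin (N + 1) → K), (∀ i, h i ≠ 0) ∧ IntermediateField.adjoin k (Set.range fun ij : Fin (N + 1) × Fin (N + 1) => h ij.1 * (h ij.2)⁻¹) = ⊤ ∧ (∀ L : ℕ, ∃ O : ValuationSubring K, (∀ c : k, algebraMap k K c ∈ O) ∧ ∃ j : Fin (N + 1), (∀ i, h i * (h j)⁻¹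 ∈ O) ∧ ∃ x : ℕ → K, (∀ t, t < L → risoValid (fun (B : Subalgebra k K) (m : Ideal ↥B) (d : ℕ) => ¬ ∃ (n : ℕ) (g : Fin n → ↥B), (∀ i, g i ∈ m) ∧ Algebra.adjoin k (Set.range fun i => (g i : K)) = B ∧ ∃ W : Submodule k (Fin n → k), d + 1 ≤ Module.finrank k ↥W ∧ ∃ φ : {α : ↥B →ₐ[k] HahnSeries ℚ k // ∀ b ∈ m, 0 < (α b).orderTop} → (Fin n → HahnSeries ℚ k), (∀ a b : {α : ↥B →ₐ[k] HahnSeries ℚ k // ∀ b ∈ m, 0 < (α b).orderTop}, a ≠ b → ∃ j, ∀ i, (a.1 (g j) - b.1 (g j)).orderTop < ((φ a i - φ b i) - (a.1 (g i) - b.1 (g i))).orderTop) ∧ (∀ a i, 0 < (φ a i).orderTop) ∧ (∀ a, ∀ w : Fin n → HahnSeries ℚ k, (∀ i, 0 < (w i).orderTop) → w ∈ Submodule.span (HahnSeries ℚ k) ((fun u : Fin n → k => fun i => HahnSeries.C (u i)) '' (W : Set (Fin n → k))) → ∃ b, φ b = φ a + w)) O (risoStage (fun (B : Subalgebra k K)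 (m : Ideal ↥B) (d : ℕ) => ¬ ∃ (n : ℕ) (g : Fin n → ↥B), (∀ i, g i ∈ m) ∧ Algebra.adjoin k (Set.range fun i => (g i : K)) = B ∧ ∃ W : Submodule k (Fin n → k), d + 1 ≤ Module.finrank k ↥W ∧ ∃ φ : {α : ↥B →ₐ[k] HahnSeries ℚ k // ∀ b ∈ m, 0 < (α b).orderTop} → (Fin n → HahnSeries ℚ k), (∀ a b : {α : ↥B →ₐ[k] HahnSeries ℚ k // ∀ b ∈ m, 0 < (α b).orderTop}, a ≠ b → ∃ j, ∀ i, (a.1 (g j) - b.1 (g j)).orderTop < ((φ a i - φ b i) - (a.1 (g i) - b.1 (g i))).orderTop) ∧ (∀ a i, 0 < (φ a i).orderTop) ∧ (∀ a, ∀ w : Fin n → HahnSeries ℚ k, (∀ i, 0 < (w i).orderTop) → w ∈ Submodule.span (HahnSeries ℚ k) ((fun u : Fin n → k => fun i => HahnSeries.C (u i)) '' (W : Set (Fin n → k))) → ∃ b, φ b = φ a + w)) (Algebra.adjoin k (Set.range fun i => h i * (h j)⁻¹)) (List.replicate L 0) x t) 0 (x t)) ∧ (∀ t, t < L → ∀ (m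 : Ideal ↥(risoStage (fun (B : Subalgebra k K) (m : Ideal ↥B) (d : ℕ) => ¬ ∃ (n : ℕ) (g : Fin n → ↥B), (∀ i, g i ∈ m) ∧ Algebra.adjoin k (Set.range fun i => (g i : K)) = B ∧ ∃ W : Submodule k (Fin n → k), d + 1 ≤ Module.finrank k ↥W ∧ ∃ φ : {α : ↥B →ₐ[k] HahnSeries ℚ k // ∀ b ∈ m, 0 < (α b).orderTop} → (Fin n → HahnSeries ℚ k), (∀ a b : {α : ↥B →ₐ[k] HahnSeries ℚ k // ∀ b ∈ m, 0 < (α b).orderTop}, a ≠ b → ∃ j, ∀ i, (a.1 (g j) - b.1 (g j)).orderTop < ((φ a i - φ b i) - (a.1 (g i) - b.1 (g i))).orderTop) ∧ (∀ a i, 0 < (φ a i).orderTop) ∧ (∀ a, ∀ w : Fin n → HahnSeries ℚ k, (∀ i, 0 < (w i).orderTop) → w ∈ Submodule.span (HahnSeries ℚ k) ((fun u : Fin n → k => fun i => HahnSeries.C (u i)) '' (W : Set (Fin n → k))) → ∃ b, φ b = φ a + w)) (Algebra.adjoin k (Set.range fun i => h i * (h j)⁻¹)) (List.replicate L 0) x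 t)) (hm : m.IsMaximal), ¬ IsRegularLocalRing (Localization (@Ideal.primeCompl _ _ m hm.isPrime)) → ¬ (∃ (n : ℕ) (g : Fin n → ↥(risoStage (fun (B : Subalgebra k K) (m : Ideal ↥B) (d : ℕ) => ¬ ∃ (n : ℕ) (g : Fin n → ↥B), (∀ i, g i ∈ m) ∧ Algebra.adjoin k (Set.range fun i => (g i : K)) = B ∧ ∃ W : Submodule k (Fin n → k), d + 1 ≤ Module.finrank k ↥W ∧ ∃ φ : {α : ↥B →ₐ[k] HahnSeries ℚ k // ∀ b ∈ m, 0 < (α b).orderTop} → (Fin n → HahnSeries ℚ k), (∀ a b : {α : ↥B →ₐ[k] HahnSeries ℚ k // ∀ b ∈ m, 0 < (α b).orderTop}, a ≠ b → ∃ j, ∀ i, (a.1 (g j) - b.1 (g j)).orderTop < ((φ a i - φ b i) - (a.1 (g i) - b.1 (g i))).orderTop) ∧ (∀ a i, 0 < (φ a i).orderTop) ∧ (∀ a, ∀ w : Fin n → HahnSeries ℚ k, (∀ i, 0 < (w i).orderTop) → w ∈ Submodule.span (HahnSeries ℚ k) ((fun u : Fin n → k => fun i => HahnSeries.C (u i))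 '' (W : Set (Fin n → k))) → ∃ b, φ b = φ a + w)) (Algebra.adjoin k (Set.range fun i => h i * (h j)⁻¹)) (List.replicate L 0) x t)), (∀ i, g i ∈ m) ∧ Algebra.adjoin k (Set.range fun i => (g i : K)) = (risoStage (fun (B : Subalgebra k K) (m : Ideal ↥B) (d : ℕ) => ¬ ∃ (n : ℕ) (g : Fin n → ↥B), (∀ i, g i ∈ m) ∧ Algebra.adjoin k (Set.range fun i => (g i : K)) = B ∧ ∃ W : Submodule k (Fin n → k), d + 1 ≤ Module.finrank k ↥W ∧ ∃ φ : {α : ↥B →ₐ[k] HahnSeries ℚ k // ∀ b ∈ m, 0 < (α b).orderTop} → (Fin n → HahnSeries ℚ k), (∀ a b : {α : ↥B →ₐ[k] HahnSeries ℚ k // ∀ b ∈ m, 0 < (α b).orderTop}, a ≠ b → ∃ j, ∀ i, (a.1 (g j) - b.1 (g j)).orderTop < ((φ a i - φ b i) - (a.1 (g i) - b.1 (g i))).orderTop) ∧ (∀ a i, 0 < (φ a i).orderTop) ∧ (∀ a, ∀ w : Fin n → HahnSeries ℚ k, (∀ i, 0 < (w i).orderTop) → w ∈ Submodule.span (HahnSeries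 ℚ k) ((fun u : Fin n → k => fun i => HahnSeries.C (u i)) '' (W : Set (Fin n → k))) → ∃ b, φ b = φ a + w)) (Algebra.adjoin k (Set.range fun i => h i * (h j)⁻¹)) (List.replicate L 0) x t) ∧ ∃ W : Submodule k (Fin n → k), 1 ≤ Module.finrank k ↥W ∧ ∃ φ : {α : ↥(risoStage (fun (B : Subalgebra k K) (m : Ideal ↥B) (d : ℕ) => ¬ ∃ (n : ℕ) (g : Fin n → ↥B), (∀ i, g i ∈ m) ∧ Algebra.adjoin k (Set.range fun i => (g i : K)) = B ∧ ∃ W : Submodule k (Fin n → k), d + 1 ≤ Module.finrank k ↥W ∧ ∃ φ : {α : ↥B →ₐ[k] HahnSeries ℚ k // ∀ b ∈ m, 0 < (α b).orderTop} → (Fin n → HahnSeries ℚ k), (∀ a b : {α : ↥B →ₐ[k] HahnSeries ℚ k // ∀ b ∈ m, 0 < (α b).orderTop}, a ≠ b → ∃ j, ∀ i, (a.1 (g j) - b.1 (g j)).orderTop < ((φ a i - φ b i) - (a.1 (g i) - b.1 (g i))).orderTop) ∧ (∀ a i, 0 < (φ a i).orderTop) ∧ (∀ a, ∀ w : Fin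 n → HahnSeries ℚ k, (∀ i, 0 < (w i).orderTop) → w ∈ Submodule.span (HahnSeries ℚ k) ((fun u : Fin n → k => fun i => HahnSeries.C (u i)) '' (W : Set (Fin n → k))) → ∃ b, φ b = φ a + w)) (Algebra.adjoin k (Set.range fun i => h i * (h j)⁻¹)) (List.replicate L 0) x t) →ₐ[k] HahnSeries ℚ k // ∀ b ∈ m, 0 < (α b).orderTop} → (Fin n → HahnSeries ℚ k), (∀ a b : {α : ↥(risoStage (fun (B : Subalgebra k K) (m : Ideal ↥B) (d : ℕ) => ¬ ∃ (n : ℕ) (g : Fin n → ↥B), (∀ i, g i ∈ m) ∧ Algebra.adjoin k (Set.range fun i => (g i : K)) = B ∧ ∃ W : Submodule k (Fin n → k), d + 1 ≤ Module.finrank k ↥W ∧ ∃ φ : {α : ↥B →ₐ[k] HahnSeries ℚ k // ∀ b ∈ m, 0 < (α b).orderTop} → (Fin n → HahnSeries ℚ k), (∀ a b : {α : ↥B →ₐ[k] HahnSeries ℚ k // ∀ b ∈ m, 0 < (α b).orderTop}, a ≠ b → ∃ j, ∀ i, (a.1 (g j) - b.1 (g j)).orderTop < ((φ a i - φ b i)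 - (a.1 (g i) - b.1 (g i))).orderTop) ∧ (∀ a i, 0 < (φ a i).orderTop) ∧ (∀ a, ∀ w : Fin n → HahnSeries ℚ k, (∀ i, 0 < (w i).orderTop) → w ∈ Submodule.span (HahnSeries ℚ k) ((fun u : Fin n → k => fun i => HahnSeries.C (u i)) '' (W : Set (Fin n → k))) → ∃ b, φ b = φ a + w)) (Algebra.adjoin k (Set.range fun i => h i * (h j)⁻¹)) (List.replicate L 0) x t) →ₐ[k] HahnSeries ℚ k // ∀ b ∈ m, 0 < (α b).orderTop}, a ≠ b → ∃ j, ∀ i, (a.1 (g j) - b.1 (g j)).orderTop < ((φ a i - φ b i) - (a.1 (g i) - b.1 (g i))).orderTop) ∧ (∀ a i, 0 < (φ a i).orderTop) ∧ (∀ a, ∀ w : Fin n → HahnSeries ℚ k, (∀ i, 0 < (w i).orderTop) → w ∈ Submodule.span (HahnSeries ℚ k) ((fun u : Fin n → k => fun i => HahnSeries.C (u i)) '' (W : Set (Fin n → k))) → ∃ b, φ b = φ a + w))) ∧ ¬ IsRegularLocalRing ↥(risoLoc O (risoStage (fun (B : Subalgebra k K) (m : Ideal ↥B) (d : ℕ)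 => ¬ ∃ (n : ℕ) (g : Fin n → ↥B), (∀ i, g i ∈ m) ∧ Algebra.adjoin k (Set.range fun i => (g i : K)) = B ∧ ∃ W : Submodule k (Fin n → k), d + 1 ≤ Module.finrank k ↥W ∧ ∃ φ : {α : ↥B →ₐ[k] HahnSeries ℚ k // ∀ b ∈ m, 0 < (α b).orderTop} → (Fin n → HahnSeries ℚ k), (∀ a b : {α : ↥B →ₐ[k] HahnSeries ℚ k // ∀ b ∈ m, 0 < (α b).orderTop}, a ≠ b → ∃ j, ∀ i, (a.1 (g j) - b.1 (g j)).orderTop < ((φ a i - φ b i) - (a.1 (g i) - b.1 (g i))).orderTop) ∧ (∀ a i, 0 < (φ a i).orderTop) ∧ (∀ a, ∀ w : Fin n → HahnSeries ℚ k, (∀ i, 0 < (w i).orderTop) → w ∈ Submodule.span (HahnSeries ℚ k) ((fun u : Fin n → k => fun i => HahnSeries.C (u i)) '' (W : Set (Fin n → k))) → ∃ b, φ b = φ a + w)) (Algebra.adjoin k (Set.range fun i => h i * (h j)⁻¹)) (List.replicate L 0) x L)))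

/-- **`CollapsedTowerLoop → ¬ RisoCentresResolve`.** A presentation on which, for every length,
the constant word admits an admissible tower along some valuation ring that ends non-regular and
along whose own stages every singular maximal ideal has typed rtd `0`, refutes the crux: the crux's
schedule of that length defines, with the same denominators, the same stages
(`risoStep_eq_of_collapse` stage by stage), with the same admissibility
(`risoValid_iff_of_collapse`), hence a regular final local ring — contradicting LOOP. [folklore] -/
theorem RisoCentresResolve_false_of_CollapsedTowerLoop :
    CollapsedTowerLoop → ¬ RisoCentresResolve := by
  rintro ⟨p, hp, k, _, _, _, K, _, _, N, h, hh, hgen, hloop⟩ hR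
  set P : ∀ B : Subalgebra k K, Ideal ↥B → ℕ → Prop := (fun (B : Subalgebra k K) (m : Ideal ↥B) (d : ℕ) => ¬ ∃ (n : ℕ) (g : Fin n → ↥B), (∀ i, g i ∈ m) ∧ Algebra.adjoin k (Set.range fun i => (g i : K)) = B ∧ ∃ W : Submodule k (Fin n → k), d + 1 ≤ Module.finrank k ↥W ∧ ∃ φ : {α : ↥B →ₐ[k] HahnSeries ℚ k // ∀ b ∈ m, 0 < (α b).orderTop} → (Fin n → HahnSeries ℚ k), (∀ a b : {α : ↥B →ₐ[k] HahnSeries ℚ k // ∀ b ∈ m, 0 < (α b).orderTop}, a ≠ b → ∃ j, ∀ i, (a.1 (g j) - b.1 (g j)).orderTop < ((φ a i - φ b i) - (a.1 (g i) - b.1 (g i))).orderTop) ∧ (∀ a i, 0 < (φ a i).orderTop) ∧ (∀ a, ∀ w : Fin n → HahnSeries ℚ k, (∀ i, 0 < (w i).orderTop) → w ∈ Submodule.span (HahnSeries ℚ k) ((fun u : Fin n → k => fun i => HahnSeries.C (u i)) '' (W : Set (Fin n → k))) → ∃ b, φ b = φ a + w)) with hPdef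
  have hs : RisoSchedule P N h := hR p hp k K N h hh hgen
  obtain ⟨sched, hsched⟩ := hs
  obtain ⟨O, hk, j, hj, x, hvalid, hcol, hnreg⟩ := hloop sched.length
  set B₀ : Subalgebra k K := Algebra.adjoin k (Set.range fun i => h i * (h j)⁻¹) with hB₀def
  -- local collapse at stage `t`: the cut holds at every singular maximal ideal for every letter
  have hPt : ∀ t, t < sched.length →
      ∀ (m : Ideal ↥(risoStage P B₀ (List.replicate sched.length 0) x t)) (hm : m.IsMaximal),
        ¬ IsRegularLocalRing (Localization (@Ideal.primeCompl _ _ m hm.isPrime)) →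
          ∀ d, P (risoStage P B₀ (List.replicate sched.length 0) x t) m d := by
    intro t ht m hm hreg d
    rintro ⟨n, g, hg, hgen', W, hW, φ, h1, h2, h3⟩
    exact hcol t ht m hm hreg ⟨n, g, hg, hgen', W, le_trans (Nat.le_add_left 1 d) hW, φ, h1, h2, h3⟩
  -- the two towers coincide stage by stage
  have key : ∀ t, t ≤ sched.length →
      risoStage P B₀ sched x t = risoStage P B₀ (List.replicate sched.length 0) x t := by
    intro t
    induction t with
    | zero => intro; rw [risoStage_zero, risoStage_zero]
    | succ t ih =>
      intro ht
      have h1 : t < sched.length := Nat.lt_of_succ_le ht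
      have h2 : t < (List.replicate sched.length 0).length := by
        rw [List.length_replicate]; exact h1
      rw [risoStage_succ P B₀ sched x h1, risoStage_succ P B₀ _ x h2, ih h1.le,
        risoStep_eq_of_collapse P _ (hPt t h1) (sched.getD t 0) ((List.replicate sched.length 0).getD t 0)]
  apply hnreg
  rw [← key sched.length le_rfl]
  apply hsched O hk j hj x
  intro t ht
  rw [key t ht.le, risoValid_iff_of_collapse P O _ (hPt t ht) (sched.getD t 0) 0 (x t)]
  exact hvalid t ht

end Summit.ResolutionOfSingularities.ResolutionOfSingularities.Theorems

end
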